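import Mathlib.Geometry.Manifold.BumpFunction
import Mathlib.Geometry.Manifold.VectorBundle.LocalFrame
import Mathlib.Geometry.Manifold.VectorBundle.ContMDiffSection
import Mathlib.MeasureTheory.Integral.IntervalIntegral.Basic
import Mathlib.Analysis.SpecialFunctions.Pow.Real
import Literature.Geometry.Lorentzian.Hypersurface
import Literature.Geometry.Riemannian.NormalExponentialMap
import HarnessLib

/-!
# Preliminaries for the maximiser half of Hawking's singularity theorem

Three auxiliary results for the maximiser half `hmax` of
`HawkingCrushBound_of_maximiser_of_secondVariation` (O'Neill 1983, Ch. 14, Thm. 14.44: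
normality of a maximising geodesic from a spacelike hypersurface, via Cor. 10.26), all PROVED:

* `exists_contMDiff_tangentSection_eq` — every tangent vector `v₀ ∈ T_{x₀}M` of a Hausdorff
  finite-dimensional manifold extends to a `C^∞` vector field (bump function times the local
  frame of the tangent bundle; used to embed the initial velocity of a maximising geodesic into a
  smooth transverse field along the hypersurface).
* `PseudoRiemannianMetric.eq_smul_normal_of_forall_val_mfderiv_eq_zero` — for a spacelike
  immersion `f : N → M` of codimension one with unit normal field `ν` of sign `-1`, a vector at
  `f y` orthogonal to `df_y(T_yN)` is the multiple `-g(u, ν) ν(y)` of the normal (O'Neill 1983,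
  Ch. 4, p. 98: `T_p M = T_p S ⊕ (T_p S)^⊥`).
* `integral_nonneg_of_sqrt_integral_le_linear` — the limiting argument of the FIRST variation:
  if `∫₀ᵇ √(N(t, σ)) dt ≤ c₀ b` for all small `σ > 0` while `N(t, σ) ≥ c₀² - 2σ k(t) - σ² r(t)`,
  then `∫₀ᵇ k ≥ 0` (O'Neill 1983, Ch. 10, proof of Cor. 10.26: `L'(0) = 0` for every
  endmanifold variation of a maximising geodesic).

No definitions and no named facts are introduced (D-0026).

## References

* B. O'Neill, *Semi-Riemannian geometry with applications to relativity*, Academic Press 1983,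
  Ch. 4, p. 98; Ch. 10, Prop. 10.2, Cor. 10.26; Ch. 14, Thm. 14.44. [ONeillSemiRiemannian1983]
-/

noncomputable section

open Bundle Set Function Filter
open scoped Manifold ContDiff Topology

namespace Literature.Geometry.Lorentzian

open Literature.Geometry.Riemannian

/-! ### Extending a tangent vector to a smooth vector field -/

section Extension

variable {E : Type*} [NormedAddCommGroup E] [NormedSpace ℝ E] [FiniteDimensional ℝ E]
  {H : Type*} [TopologicalSpace H] {I : ModelWithCorners ℝ E H}
  {M : Type*} [TopologicalSpace M] [ChartedSpace H M] [IsManifold I ∞ M] [T2Space M]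

/-- **Every tangent vector extends to a smooth vector field** on a Hausdorff manifold with
finite-dimensional model: `∑ᵢ cᵢ ψ sᵢ` with `ψ` a smooth bump function at `x₀`, `sᵢ` the local
frame of `TM` at `x₀` and `cᵢ` the coordinates of `v₀` (O'Neill 1983, Ch. 1, bump-function
extension of local data; Lee 2013, Lemma 8.6). [folklore] -/
theorem exists_contMDiff_tangentSection_eq (x₀ : M) (v₀ : TangentSpace I x₀) :
    ∃ Z : Π x : M, TangentSpace I x,
      ContMDiff I I.tangent ∞ (fun x ↦ (TotalSpace.mk' E x (Z x) : TangentBundle I M)) ∧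
      Z x₀ = v₀ := by
  obtain ⟨ψ⟩ : Nonempty (SmoothBumpFunction I x₀) := inferInstance
  set e₁ := trivializationAt E (TangentSpace I : M → Type _) x₀ with he₁_def
  have hx₀ : x₀ ∈ e₁.baseSet := FiberBundle.mem_baseSet_trivializationAt' x₀
  set b := Module.finBasis ℝ E with hb_def
  set c : Fin (Module.finrank ℝ E) → ℝ := fun i ↦ (e₁.basisAt b hx₀).repr v₀ i with hc_def
  set σ : Fin (Module.finrank ℝ E) → Π x : M, TangentSpace I x :=
    fun i ↦ (ψ : M → ℝ) • e₁.localFrame b i with hσ_def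
  have hσ : ∀ i, ContMDiff I (I.prod 𝓘(ℝ, E)) ∞
      (fun x ↦ (TotalSpace.mk' E x (σ i x) : TangentBundle I M)) := fun i ↦
    ContMDiffOn.smul_section_of_tsupport ψ.contMDiff.contMDiffOn (chartAt H x₀).open_source
      ψ.tsupport_subset_chartAt_source (e₁.contMDiffOn_localFrame_baseSet ∞ b i)
  refine ⟨fun x ↦ ∑ i, c i • σ i x, ?_, ?_⟩
  · rw [ModelWithCorners.tangent]
    exact ContMDiff.sum_section fun i _ ↦ (hσ i).const_smul_section (a := c i)
  · have h1 : ∀ i, σ i x₀ = e₁.basisAt b hx₀ i := by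
      intro i
      simp only [hσ_def, Pi.smul_apply', SmoothBumpFunction.eq_one, one_smul]
      exact e₁.localFrame_apply_of_mem_baseSet b hx₀
    simp only [h1, hc_def]
    exact (e₁.basisAt b hx₀).sum_repr v₀

end Extension

/-! ### The normal line of a spacelike hypersurface -/

namespace PseudoRiemannianMetric

variable {E : Type*} [NormedAddCommGroup E] [NormedSpace ℝ E] [FiniteDimensional ℝ E]
  {H : Type*} [TopologicalSpace H] {I : ModelWithCorners ℝ E H}
  {M : Type*} [TopologicalSpace M] [ChartedSpace H M] [IsManifold I ∞ M]
  {E' : Type*} [NormedAddCommGroup E'] [NormedSpace ℝ E'] [FiniteDimensional ℝ E']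
  {H' : Type*} [TopologicalSpace H'] {I' : ModelWithCorners ℝ E' H'}
  {N : Type*} [TopologicalSpace N] [ChartedSpace H' N]
  {n : ℕ∞ω} (g : PseudoRiemannianMetric I n E (TangentSpace I : M → Type _))

/-- **The orthogonal complement of the tangent space of a spacelike hypersurface is the normal
line.** Let `f : N → M` be a spacelike immersion with `dim N + 1 = dim M` and `ν` a unit normal
field of sign `-1`. If `u ∈ T_{f y}M` satisfies `g(u, df_y w) = 0` for all `w ∈ T_yN`, then
`u = -g(u, ν(y)) ν(y)`: writing `u = df_y(w) + s ν(y)` (`T_{f y}M = df_y(T_yN) ⊕ ℝ ν(y)`,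
`exists_continuousLinearEquiv_coprod_toSpanSingleton`), `0 = g(u, df w) = (f^*g)(w, w)` forces
`w = 0`. O'Neill 1983, Ch. 4, p. 98 (`T_p(M̄) = T_p(M) + T_p(M)^⊥` for a semi-Riemannian
submanifold). [cite: ONeillSemiRiemannian1983, Ch. 4, p. 98] -/
theorem eq_smul_normal_of_forall_val_mfderiv_eq_zero {f : N → M} {ν : NormalField I f}
    (hf : g.IsSpacelikeImmersion I' f) (hν : g.IsUnitNormal I' f ν (-1))
    (hdim : Module.finrank ℝ E' + 1 = Module.finrank ℝ E) {y : N} {u : TangentSpace I (f y)}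
    (hu : ∀ w : TangentSpace I' y, g.val (f y) u (mfderiv I' I f y w) = 0) :
    u = (-(g.val (f y) u (ν y))) • ν y := by
  have hinj : Injective (mfderiv I' I f y) := hf.injective_mfderiv y
  have hνr : ν y ∉ range (mfderiv I' I f y) := by
    rintro ⟨w, hw⟩
    have h1 := hν.1 y w
    rw [hw, hν.2 y] at h1
    norm_num at h1
  obtain ⟨L, hL⟩ :=
    exists_continuousLinearEquiv_coprod_toSpanSingleton (F := E) (F' := E') (A := mfderiv I' I f y)
      (v := ν y) hinj hνr hdim
  obtain ⟨⟨w, s⟩, hws⟩ := L.surjective u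
  have hu' : u = mfderiv I' I f y w + s • ν y := by
    rw [← hws]
    change (L : (E' × ℝ) →L[ℝ] E) (w, s) = _
    rw [hL, ContinuousLinearMap.coprod_apply, ContinuousLinearMap.toSpanSingleton_apply]
    rfl
  have hw0 : w = 0 := by
    by_contra hw
    have hpos := hf.inducedBilin_pos (I' := I') y hw
    have h0 := hu w
    rw [hu', map_add, add_apply, map_smul, smul_apply, hν.1 y w, smul_zero, add_zero] at h0
    rw [inducedBilin_apply] at hpos
    exact hpos.ne' h0
  have hz : mfderiv I' I f y w = 0 := by rw [hw0]; exact (mfderiv I' I f y).map_zero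
  rw [hz, zero_add] at hu'
  have hs : g.val (f y) u (ν y) = -s := by
    rw [hu', map_smul, smul_apply, hν.2 y, smul_eq_mul, mul_neg, mul_one]
  rw [hs, neg_neg]
  exact hu'

end PseudoRiemannianMetric

/-! ### The limiting argument of the first variation -/

/-- `√(1 + z) ≥ 1 + z/2 - z²/2` for `z ≥ -1`. [folklore] -/
private theorem one_add_half_sub_sq_le_sqrt' {z : ℝ} (hz : -1 ≤ z) :
    1 + z / 2 - z ^ 2 / 2 ≤ Real.sqrt (1 + z) := by
  by_cases h : 1 + z / 2 - z ^ 2 / 2 ≤ 0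
  · exact h.trans (Real.sqrt_nonneg _)
  · rw [not_le] at h
    have hz' : z < 2 := by nlinarith [sq_nonneg z]
    refine Real.le_sqrt_of_sq_le ?_
    nlinarith [sq_nonneg z, mul_nonneg (sq_nonneg z) (sub_nonneg.2 hz'.le),
      mul_nonneg (sq_nonneg z) (neg_le_iff_add_nonneg.1 hz)]

/-- **The limiting argument of the first variation.** Let `k, r` be continuous on `[0, b]`,
`b > 0`, `c₀ > 0`, and suppose that for some `δ > 0` and all `σ ∈ (0, δ]`:
`∫₀ᵇ √(N(t, σ)) dt ≤ c₀ b` while `N(t, σ) ≥ c₀² - σ (2 k(t)) - σ² r(t)` on `[0, b]` (each `N(·, σ)`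
continuous on `[0, b]`). Then `∫₀ᵇ k ≥ 0`. (Expansion `√(c₀² (1 + z)) ≥ c₀ (1 + z/2 - z²/2)`,
division by `σ` and `σ → 0`; O'Neill 1983, Ch. 10, Prop. 10.2 and Cor. 10.26: "`L'(0) = 0`" for
a geodesic extremal among curves from the endmanifold.) [folklore] -/
theorem integral_nonneg_of_sqrt_integral_le_linear {b c₀ : ℝ} (hb : 0 < b) (hc₀ : 0 < c₀)
    {k r : ℝ → ℝ} (hk : ContinuousOn k (Icc 0 b)) (hr : ContinuousOn r (Icc 0 b))
    {N : ℝ → ℝ → ℝ} (hN : ∀ σ, ContinuousOn (fun t ↦ N t σ) (Icc 0 b)) {δ : ℝ} (hδ : 0 < δ)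
    (hyp : ∀ σ ∈ Ioc (0 : ℝ) δ,
      (∫ t in (0 : ℝ)..b, Real.sqrt (N t σ)) ≤ c₀ * b ∧
        ∀ t ∈ Icc 0 b, c₀ ^ 2 - σ * (2 * k t) - σ ^ 2 * r t ≤ N t σ) :
    0 ≤ ∫ t in (0 : ℝ)..b, k t := by
  -- bounds for `|k|`, `|r|` on `[0, b]`
  obtain ⟨K₁, hK₁⟩ := (isCompact_Icc (a := (0 : ℝ)) (b := b)).exists_bound_of_continuousOn hk
  obtain ⟨K₂, hK₂⟩ := (isCompact_Icc (a := (0 : ℝ)) (b := b)).exists_bound_of_continuousOn hr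
  set K : ℝ := |K₁| + |K₂| + 1 with hKdef
  have hKpos : 0 < K := by positivity
  have hkK : ∀ t ∈ Icc 0 b, |k t| ≤ K := fun t ht ↦ by
    have h1 := hK₁ t ht
    rw [Real.norm_eq_abs] at h1
    exact h1.trans ((le_abs_self K₁).trans (by rw [hKdef]; linarith [abs_nonneg K₂]))
  have hrK : ∀ t ∈ Icc 0 b, |r t| ≤ K := fun t ht ↦ by
    have h1 := hK₂ t ht
    rw [Real.norm_eq_abs] at h1
    exact h1.trans ((le_abs_self K₂).trans (by rw [hKdef]; linarith [abs_nonneg K₁]))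
  have hki : IntervalIntegrable k MeasureTheory.volume 0 b := hk.intervalIntegrable_of_Icc hb.le
  -- the constant of the `σ²` error
  set C : ℝ := K / (2 * c₀) + c₀ * (3 * K / c₀ ^ 2) ^ 2 / 2 with hCdef
  have hCnn : 0 ≤ C := by positivity
  -- main estimate: for small `σ > 0`, `∫ k ≥ -σ c₀ C b`
  have hmain : ∀ σ : ℝ, 0 < σ → σ ≤ δ → σ ≤ 1 → σ * (3 * K / c₀ ^ 2) ≤ 1 / 2 →
      -(σ * (c₀ * C * b)) ≤ ∫ t in (0 : ℝ)..b, k t := by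
    intro σ hσ hσδ hσ1 hσK
    obtain ⟨hint, hlow⟩ := hyp σ ⟨hσ, hσδ⟩
    -- pointwise: `√N ≥ c₀ - (σ/c₀) k - σ² C`
    have hpt : ∀ t ∈ Icc 0 b, c₀ - σ / c₀ * k t - σ ^ 2 * C ≤ Real.sqrt (N t σ) := by
      intro t ht
      set z : ℝ := (-(σ * (2 * k t)) - σ ^ 2 * r t) / c₀ ^ 2 with hz
      have hc2 : 0 < c₀ ^ 2 := by positivity
      have hzb : |z| ≤ σ * (3 * K / c₀ ^ 2) := by
        rw [hz, abs_div, abs_of_pos hc2, div_le_iff₀ hc2]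
        have h1 : |(-(σ * (2 * k t)) - σ ^ 2 * r t)| ≤ σ * (2 * K) + σ ^ 2 * K := by
          calc |(-(σ * (2 * k t)) - σ ^ 2 * r t)|
              ≤ |(-(σ * (2 * k t)))| + |σ ^ 2 * r t| := abs_sub _ _
            _ = σ * (2 * |k t|) + σ ^ 2 * |r t| := by
                rw [abs_neg, abs_mul, abs_mul, abs_mul, abs_of_pos hσ, abs_of_nonneg (sq_nonneg σ),
                  abs_two]
            _ ≤ σ * (2 * K) + σ ^ 2 * K := by
                gcongr
                · exact hkK t ht
                · exact hrK t ht
        have h2 : σ ^ 2 * K ≤ σ * K := by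
          have : σ ^ 2 ≤ σ := by nlinarith
          exact mul_le_mul_of_nonneg_right this hKpos.le
        calc |(-(σ * (2 * k t)) - σ ^ 2 * r t)| ≤ σ * (2 * K) + σ ^ 2 * K := h1
          _ ≤ σ * (2 * K) + σ * K := by linarith
          _ = σ * (3 * K / c₀ ^ 2) * c₀ ^ 2 := by field_simp; ring
      have hzabs : |z| ≤ 1 / 2 := hzb.trans hσK
      have hz1 : -1 ≤ z := by linarith [(abs_le.1 hzabs).1]
      have hNz : c₀ ^ 2 * (1 + z) ≤ N t σ := by
        have : c₀ ^ 2 * (1 + z) = c₀ ^ 2 - σ * (2 * k t) - σ ^ 2 * r t := by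
          rw [hz]; field_simp; ring
        rw [this]; exact hlow t ht
      have h1 : Real.sqrt (c₀ ^ 2 * (1 + z)) ≤ Real.sqrt (N t σ) := Real.sqrt_le_sqrt hNz
      have h2 : Real.sqrt (c₀ ^ 2 * (1 + z)) = c₀ * Real.sqrt (1 + z) := by
        rw [Real.sqrt_mul (sq_nonneg _), Real.sqrt_sq hc₀.le]
      have h3 := one_add_half_sub_sq_le_sqrt' hz1
      have h4 : c₀ * (1 + z / 2 - z ^ 2 / 2) ≤ c₀ * Real.sqrt (1 + z) :=
        mul_le_mul_of_nonneg_left h3 hc₀.le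
      have h5 : z ^ 2 ≤ (σ * (3 * K / c₀ ^ 2)) ^ 2 := by
        have := pow_le_pow_left₀ (abs_nonneg _) hzb 2
        rwa [sq_abs] at this
      have h6 : c₀ * (z / 2) = -(σ / c₀ * k t) - σ ^ 2 * r t / (2 * c₀) := by
        rw [hz]; field_simp
      have h7 : σ ^ 2 * r t / (2 * c₀) ≤ σ ^ 2 * (K / (2 * c₀)) := by
        rw [mul_div_assoc]
        refine mul_le_mul_of_nonneg_left ?_ (sq_nonneg σ)
        exact div_le_div_of_nonneg_right ((le_abs_self _).trans (hrK t ht)) (by positivity)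
      have h8 : c₀ * (z ^ 2 / 2) ≤ σ ^ 2 * (c₀ * (3 * K / c₀ ^ 2) ^ 2 / 2) := by
        have := mul_le_mul_of_nonneg_left h5 (show 0 ≤ c₀ / 2 by positivity)
        calc c₀ * (z ^ 2 / 2) = c₀ / 2 * z ^ 2 := by ring
          _ ≤ c₀ / 2 * (σ * (3 * K / c₀ ^ 2)) ^ 2 := this
          _ = σ ^ 2 * (c₀ * (3 * K / c₀ ^ 2) ^ 2 / 2) := by ring
      calc c₀ - σ / c₀ * k t - σ ^ 2 * C
          = c₀ - σ / c₀ * k t - σ ^ 2 * (K / (2 * c₀)) -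
              σ ^ 2 * (c₀ * (3 * K / c₀ ^ 2) ^ 2 / 2) := by rw [hCdef]; ring
        _ ≤ c₀ + c₀ * (z / 2) - c₀ * (z ^ 2 / 2) := by rw [h6]; linarith
        _ = c₀ * (1 + z / 2 - z ^ 2 / 2) := by ring
        _ ≤ Real.sqrt (N t σ) := h4.trans (h2 ▸ h1)
    -- integrate
    have hcont1 : ContinuousOn (fun t ↦ c₀ - σ / c₀ * k t - σ ^ 2 * C) (Icc 0 b) :=
      (continuousOn_const.sub (hk.const_smul (σ / c₀))).sub continuousOn_const
    have hcont2 : ContinuousOn (fun t ↦ Real.sqrt (N t σ)) (Icc 0 b) :=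
      Real.continuous_sqrt.comp_continuousOn (hN σ)
    have hI := intervalIntegral.integral_mono_on hb.le
      (hcont1.intervalIntegrable_of_Icc (μ := MeasureTheory.volume) hb.le)
      (hcont2.intervalIntegrable_of_Icc (μ := MeasureTheory.volume) hb.le) hpt
    have hsplit : ∫ t in (0 : ℝ)..b, (c₀ - σ / c₀ * k t - σ ^ 2 * C) =
        c₀ * b - σ / c₀ * (∫ t in (0 : ℝ)..b, k t) - σ ^ 2 * C * b := by
      rw [intervalIntegral.integral_sub (intervalIntegrable_const.sub (hki.const_mul _))
          intervalIntegrable_const,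
        intervalIntegral.integral_sub intervalIntegrable_const (hki.const_mul _),
        intervalIntegral.integral_const, intervalIntegral.integral_const,
        intervalIntegral.integral_const_mul, sub_zero, smul_eq_mul, smul_eq_mul]
      ring
    rw [hsplit] at hI
    have h9 : c₀ * b - σ / c₀ * (∫ t in (0 : ℝ)..b, k t) - σ ^ 2 * C * b ≤ c₀ * b :=
      hI.trans hint
    have h10 : σ / c₀ * (∫ t in (0 : ℝ)..b, k t) ≥ -(σ ^ 2 * C * b) := by linarith
    -- divide by `σ / c₀ > 0`
    have h11 : (∫ t in (0 : ℝ)..b, k t) ≥ -(σ ^ 2 * C * b) / (σ / c₀) := by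
      rw [ge_iff_le, div_le_iff₀ (div_pos hσ hc₀)]
      linarith
    have h12 : -(σ ^ 2 * C * b) / (σ / c₀) = -(σ * (c₀ * C * b)) := by
      field_simp
    linarith [h11, h12]
  -- let `σ → 0`
  by_contra hneg
  rw [not_le] at hneg
  set A : ℝ := -∫ t in (0 : ℝ)..b, k t with hA
  have hApos : 0 < A := by rw [hA]; linarith
  -- choose `σ` with all smallness conditions and `σ c₀ C b < A`
  set σ : ℝ := min (min δ 1) (min (1 / 2 / (3 * K / c₀ ^ 2 + 1)) (A / (c₀ * C * b + 1) / 2))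
    with hσdef
  have hq1 : 0 < 3 * K / c₀ ^ 2 + 1 := by positivity
  have hq2 : 0 < c₀ * C * b + 1 := by positivity
  have hσpos : 0 < σ := by
    rw [hσdef]
    refine lt_min (lt_min hδ one_pos) (lt_min (by positivity) (by positivity))
  have hσδ : σ ≤ δ := (min_le_left _ _).trans (min_le_left _ _)
  have hσ1 : σ ≤ 1 := (min_le_left _ _).trans (min_le_right _ _)
  have hσK : σ * (3 * K / c₀ ^ 2) ≤ 1 / 2 := by
    have h1 : σ ≤ 1 / 2 / (3 * K / c₀ ^ 2 + 1) := (min_le_right _ _).trans (min_le_left _ _)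
    have h2 : σ * (3 * K / c₀ ^ 2 + 1) ≤ 1 / 2 := by rwa [le_div_iff₀ hq1] at h1
    nlinarith [hσpos.le]
  have hσA : σ * (c₀ * C * b) < A := by
    have h1 : σ ≤ A / (c₀ * C * b + 1) / 2 := (min_le_right _ _).trans (min_le_right _ _)
    have h2 : A / (c₀ * C * b + 1) / 2 < A / (c₀ * C * b + 1) := by
      linarith [div_pos hApos hq2]
    have h3 : σ < A / (c₀ * C * b + 1) := lt_of_le_of_lt h1 h2
    rw [lt_div_iff₀ hq2] at h3
    nlinarith [hσpos.le, mul_nonneg (mul_nonneg hc₀.le hCnn) hb.le]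
  have := hmain σ hσpos hσδ hσ1 hσK
  rw [hA] at hσA
  linarith

end Literature.Geometry.Lorentzian

end
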